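import Summits.BirchSwinnertonDyer.Rank1Residual.Additive.ChiBranchRatLowerDvdOdd
import Summits.BirchSwinnertonDyer.Rank1Residual.Additive.ChiBranchRatLowerDvdMultOdd
import HarnessLib

/-!
# Sanity / non-vacuity of the one-sided nodes: on the UNIT rows (`ord_p L(E,1)/Ω_E = 0`) the typed
# containments `ChiBranchRatLowerDvdOddAt` / `ChiBranchRatLowerDvdMultOddAt` — hence the rational branch
# main conjectures `ChiBranchRatCharEq[Mult]OddAt` — are THEOREMS from Kato's printed half alone
# (cell `b2b-bsdres`, team n1011, seat n1011-p06 gen 2, OWNERS row T-N10R, phase 4, unit-row discharge)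

HONEST FRAMING (cell `b2b-bsdres`, run/shared/lean/b2b/bsd-rank1-residual/, verbatim in every
file): the goal of the cell is to DELETE the COMBINATION-SHAPED residual classes of the
Birch–Swinnerton-Dyer formula for ALL analytic-rank `≤ 1` elliptic curves over `ℚ` — "full BSD
formula for every rank `≤ 1` curve in class `C`" assembled STRICTLY from published theorems — so
that the rank-`≤ 1` remainder becomes exactly the CONSTRUCTION-SHAPED classes, which are TYPED
(missing-input `Prop`s), NOT attempted. This is not "finishing BSD". Team n1011 (X4 ∧ `p = 3` / the
additive block, §I items N10 / N11): research routes; prove what is provable now; no claim beyond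
the stated classes; X4♯(G-ord) / X4(M) stay CONSTRUCTION-SHAPED; labels / census / located gap
UNCHANGED; nothing is booked. Theorems only (no definition, no named fact minted; the Literature input
is the explicit binder `hKW` / `hKato` = the Kato/Wuthrich half-eigenspace reading).

## What and why

The typed nodes of this seat's phase 4 (`ChiBranchRatLowerDvdOddAt W p`, p252762;
`ChiBranchRatLowerDvdMultOddAt W p`, p253261) say: every `g ∈ char_Λ X(E/ℚ_∞)` is a `Λ ⊗ ℚ_p`-multiple
of the Néron-normalised branch series `ϖ L_br` of the twist. On a UNIT row — `L(E,1) = q·Ω_E` with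
`ord_p q = 0`, the rows on which census-ctyper-1 showed the `μ`-certificate is free
(`CensusX41.unitCoeffCert_odd`) — the constant term of `ϖ L_br` is a `p`-adic unit (MTT §I.13–I.14 +
the odd Birch/Pal identity `entireLFunction_one_eq_of_twist_neg`, the correcting factors `|u(C)|`,
`c_∞(E)`, `ε`, `a_p` being `p`-units), so Kato's element `g₁ ∈ char_Λ X` with `ι g₁ = u·ϖ L_br` (this
seat's full-series transport, §1 of the two node files) is a UNIT of `Λ` (`PowerSeries.isUnit_iff_constantCoeff`);
hence `char_Λ X = Λ` and the node holds with `G = u⁻¹ g₁`, `m = n = 0`. With the splits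
(`chiBranchRatCharEq[Mult]OddAt_of_katoHalf_of_ratLowerDvd`) the rational branch main conjectures
`ChiBranchRatCharEqOddAt W p` / `ChiBranchRatCharEqMultOddAt W p` are therefore THEOREMS on the unit
rows (given the tower of `W`): the typed input of T-N10R is discharged exactly where the Q6 certificate
has index `n₀ = 0` — a non-vacuity check of the nodes, and the `λ^{an} = 0` instance of the
"rank `≥ λ^{an}` ⟹ main conjecture" mechanism of ROUTE-2 II.9 / T-E3d (n1011-p10's row; this file
may be cited there as its unit case — nothing of that row is written here). On these rows the LOWER
half of `BSD(E,p)` is numerically idle for X4 ∧ surj; the content is the main-conjecture node itself.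
Nothing booked; no label change.

References: K. Kato, Astérisque 295 (2004) Thm. 17.4 (3) (p. 273) [Kato2004Asterisque]; C. Wuthrich,
J. London Math. Soc. 90 (2014) Thm. 3, Cor. 19 [Wuthrich2014]; Mazur–Tate–Teitelbaum, Invent. Math. 84
(1986) §I.10, §I.13–I.14 [MazurTateTeitelbaum1986Invent]; A. Pal, Proc. AMS (2012) Thm. 3.2 [Pal2012];
C. Skinner, E. Urban, Invent. Math. 195 (2014) Thm. 3.6.4 (p. 43) [SkinnerUrban2014].
-/

noncomputable section

open scoped Classical MatrixGroups ModularForm NumberField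

open CongruenceSubgroup WeierstrassCurve NumberField Literature.NumberTheory.EllipticCurves
  Literature.NumberTheory.EllipticCurves.ModularForms
  Literature.NumberTheory.EllipticCurves.Rank1Residual
  Literature.NumberTheory.EllipticCurves.Rank1Residual.Typed
  Literature.NumberTheory.GaloisRepresentations
  IsDedekindDomain

namespace Summit.BirchSwinnertonDyer.Rank1Residual.Additive

open AdditivePotMult

/-! ### §0 Algebra: an element of `Λ` whose image has unit constant term generates `Λ` -/

section Algebra

variable (p : ℕ) [hp : Fact p.Prime]

/-- If `G ∈ Λ = ℤ_p⟦T⟧` maps under `ι : Λ ↪ ℚ_p⟦T⟧` to a series with constant term of norm `1`, then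
`G` is a unit and `(G) = Λ` (`PowerSeries.isUnit_iff_constantCoeff`, `PadicInt.isUnit_iff`). [folklore] -/
theorem span_singleton_eq_top_of_map_eq_of_norm_constantCoeff_eq_one {G : IwasawaAlgebra p}
    {L : PowerSeries ℚ_[p]} (hG : iwasawaToPowerSeries p G = L)
    (h1 : ‖PowerSeries.constantCoeff L‖ = 1) : Ideal.span {G} = ⊤ := by
  have h0 : ((PowerSeries.constantCoeff G : ℤ_[p]) : ℚ_[p]) = PowerSeries.constantCoeff L := by
    rw [← hG, constantCoeff_iwasawaToPowerSeries]
  have hn : ‖(PowerSeries.constantCoeff G : ℤ_[p])‖ = 1 := by rw [PadicInt.norm_def, h0, h1]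
  exact Ideal.span_singleton_eq_top.mpr
    (PowerSeries.isUnit_iff_constantCoeff.mpr (PadicInt.isUnit_iff.mpr hn))

/-- `‖r‖_p = 1` for a nonzero rational of `p`-adic valuation `0`. [folklore] -/
theorem norm_ratCast_padic_eq_one_of_padicValRat_eq_zero {r : ℚ} (hr : r ≠ 0)
    (hv : padicValRat p r = 0) : ‖((r : ℚ) : ℚ_[p])‖ = 1 := by
  have hrQ : ((r : ℚ) : ℚ_[p]) ≠ 0 := by exact_mod_cast hr
  rw [Padic.norm_eq_zpow_neg_valuation hrQ, Padic.valuation_ratCast, hv, neg_zero, zpow_zero]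

end Algebra

/-! ### §1 (G-ord) odd branch: the node and the rational MC on the unit rows -/

section GordOdd

variable {W : WeierstrassCurve ℚ} [W.IsElliptic] [W.IsGloballyMinimal] {p : ℕ} [hp : Fact p.Prime]

/-- **UNIT rows, (G-ord) odd branch: Kato's half ALONE gives the one-sided node
`ChiBranchRatLowerDvdOddAt W p`.** For `W` globally minimal, additive and potentially good at
`p ≡ 3 (mod 4)` (`0 ≤ ord_p j`), `ρ̄_{W,p^n}` onto for all `n`, and `L(E,1) = q·Ω_E` with `q ≠ 0`,
`ord_p q = 0`: for every twist datum, Kato's `g₁ ∈ char_Λ X(E/ℚ_∞)` with `ι g₁ = u·ϖ·L_p⁻(f♭, α, ω^{(p−1)/2}, T)`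
has UNIT constant term — `‖(ϖ L_p⁻)(0)‖ = ‖ϖ·∑(a/p)[a/p]⁻_f‖ = ‖c_∞(E)·q‖ = 1`
(`CensusX41.norm_coeff_zero_odd`) — so `(u⁻¹ g₁) = Λ ∋ g` for every `g`, with `ι(u⁻¹ g₁) = ϖ L_p⁻`.
[cite: Kato2004Asterisque, Thm. 17.4 (3) (p. 273)] [cite: MazurTateTeitelbaum1986Invent, §I.13–I.14]
[cite: Pal2012, Thm. 3.2] -/
theorem chiBranchRatLowerDvdOddAt_of_katoHalf_of_unitLValue
    (hKW : Wuthrich2014.kato_halfEigenCharIdeal_dvd_cyclotomicPrime_of_surjective)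
    (hmod : hasEntireLFunction_rat) (hj : 0 ≤ padicValRat p W.j)
    (htower : ∀ n : ℕ, W.HasSurjectiveModNGaloisRep (p ^ n : ℕ)) (hadd : Addv W p)
    {q : ℚ} (hq : W.entireLFunction 1 = (q : ℂ) * (W.realPeriodRat : ℂ)) (hq0 : q ≠ 0)
    (hv : padicValRat p q = 0) :
    ChiBranchRatLowerDvdOddAt W p := by
  intro V _ _ κ γ N _ f hp3 hCW hV hκ hγ hcv hf D ϖ hϖ g _hg
  have hp2 : p ≠ 2 := by omega
  have hpne : (-(p : ℚ)) ≠ 0 := neg_ne_zero.mpr (Nat.cast_ne_zero.mpr hp.out.ne_zero)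
  have hsurjV : ∀ n : ℕ, V.HasSurjectiveModNGaloisRep (p ^ n : ℕ) := fun n ↦
    (GaloisImage.hasSurjectiveModNGaloisRep_pow_iff_of_model_twist V p hpne hCW n).mp (htower n)
  -- Kato's element
  obtain ⟨-, g₁, -, u, hιg₁⟩ :=
    exists_mem_charIdeal_map_eq_unit_mul_minusBranch_of_katoHalf W p hKW hj V hp3 hCW (Or.inl hV)
      hsurjV hκ hγ hcv hf D ϖ hϖ
  -- `G := u⁻¹ g₁`, `ι G = ϖ L⁻`
  have hCu : iwasawaToPowerSeries p (PowerSeries.C ((u⁻¹ : ℤ_[p]ˣ) : ℤ_[p])) =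
      PowerSeries.C ((((u⁻¹ : ℤ_[p]ˣ) : ℤ_[p]) : ℚ_[p])) := by
    rw [PowerSeries.map_C, PadicInt.algebraMap_apply]
  have hu0 : (((u : ℤ_[p]) : ℚ_[p])) ≠ 0 := by
    intro h0
    have h1 : (((u⁻¹ : ℤ_[p]ˣ) : ℤ_[p]) : ℚ_[p]) * (((u : ℤ_[p]) : ℚ_[p])) = 1 := by
      rw [← PadicInt.coe_mul, Units.inv_mul, PadicInt.coe_one]
    rw [h0, mul_zero] at h1
    exact zero_ne_one h1
  have hιG : iwasawaToPowerSeries p (PowerSeries.C ((u⁻¹ : ℤ_[p]ˣ) : ℤ_[p]) * g₁) =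
      PowerSeries.C (ϖ : ℚ_[p]) * padicLFunctionMinusBranch f (unitRoot V p : ℚ_[p]) (p / 2) := by
    rw [map_mul, hιg₁, hCu, ← mul_assoc, ← map_mul, coe_units_inv_eq_inv, ← mul_assoc,
      inv_mul_cancel₀ hu0, one_mul]
  -- the constant term of `ϖ L⁻` is a unit on a unit row
  obtain ⟨C, hC⟩ := hCW
  have hord : IsOrdinaryAt V p := (isOrdinaryAt_iff V p).mpr ⟨hV.1, hV.2⟩
  obtain ⟨hnorm, hL⟩ := CensusX41.norm_coeff_zero_odd p hmod hp3 V W C hC hord hadd hf ϖ hϖ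
  set c : ℕ := (W.baseChange ℝ).numRealComponents with hc
  have hc12 : c = 1 ∨ c = 2 := by
    rw [hc, numRealComponents]
    split_ifs
    · exact Or.inr rfl
    · exact Or.inl rfl
  have hc0 : (c : ℚ) ≠ 0 := by rcases hc12 with h | h <;> rw [h] <;> norm_num
  have hcv : padicValRat p (c : ℚ) = 0 := by
    rcases hc12 with h | h
    · rw [h, Nat.cast_one]; exact padicValRat.one
    · have h2 : padicValRat p ((2 : ℕ) : ℚ) = 0 := by
        rw [padicValRat.of_nat, Nat.cast_eq_zero]
        exact padicValNat_primes hp2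
      rw [h]
      exact_mod_cast h2
  have hΩ : (W.realPeriodRat : ℂ) ≠ 0 := by exact_mod_cast W.realPeriodRat_pos_holds.ne'
  have hqS : ϖ * legendreMinusSymbolSum f p = c * q := by
    have h : ((ϖ * legendreMinusSymbolSum f p / (c : ℚ) : ℚ) : ℂ) = (q : ℂ) :=
      mul_right_cancel₀ hΩ (hL.symm.trans hq)
    have h' : ϖ * legendreMinusSymbolSum f p / (c : ℚ) = q := by exact_mod_cast h
    rw [div_eq_iff hc0] at h'
    rw [h', mul_comm]
  have h1 : ‖PowerSeries.constantCoeff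
      (PowerSeries.C (ϖ : ℚ_[p]) * padicLFunctionMinusBranch f (unitRoot V p : ℚ_[p]) (p / 2))‖ = 1 := by
    rw [← PowerSeries.coeff_zero_eq_constantCoeff_apply, hnorm, hqS]
    exact norm_ratCast_padic_eq_one_of_padicValRat_eq_zero p (mul_ne_zero hc0 hq0)
      (by rw [padicValRat.mul hc0 hq0, hcv, hv, add_zero])
  -- the node with `G = u⁻¹ g₁`, `m = n = 0`
  refine ⟨PowerSeries.C ((u⁻¹ : ℤ_[p]ˣ) : ℤ_[p]) * g₁, 0, 0, ?_, ?_⟩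
  · rw [span_singleton_eq_top_of_map_eq_of_norm_constantCoeff_eq_one p hιG h1]
    exact Submodule.mem_top
  · rw [pow_zero, map_one, one_mul, hιG]

/-- **UNIT rows, (G-ord) odd branch: the rational `ω^{(p−1)/2}`-branch main conjecture
`ChiBranchRatCharEqOddAt W p` is a THEOREM from Kato's half** (the node above + the split
`chiBranchRatCharEqOddAt_of_katoHalf_of_ratLowerDvd`): `char_Λ X(E/ℚ_∞) = (p^k·ϖ L_p⁻)` — i.e. `X`
has trivial characteristic ideal. The typed input of T-N10R is discharged exactly on the rows where the
Q6 certificate has index `n₀ = 0`. [cite: Kato2004Asterisque, Thm. 17.4 (3) (p. 273)]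
[cite: SkinnerUrban2014, Thm. 3.6.4, proof (p. 43)] -/
theorem chiBranchRatCharEqOddAt_of_katoHalf_of_unitLValue
    (hKW : Wuthrich2014.kato_halfEigenCharIdeal_dvd_cyclotomicPrime_of_surjective)
    (hmod : hasEntireLFunction_rat) (hj : 0 ≤ padicValRat p W.j)
    (htower : ∀ n : ℕ, W.HasSurjectiveModNGaloisRep (p ^ n : ℕ)) (hadd : Addv W p)
    {q : ℚ} (hq : W.entireLFunction 1 = (q : ℂ) * (W.realPeriodRat : ℂ)) (hq0 : q ≠ 0)
    (hv : padicValRat p q = 0) :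
    ChiBranchRatCharEqOddAt W p :=
  chiBranchRatCharEqOddAt_of_katoHalf_of_ratLowerDvd hKW hj htower
    (chiBranchRatLowerDvdOddAt_of_katoHalf_of_unitLValue hKW hmod hj htower hadd hq hq0 hv)

/-- **X4♯(G-ord) at `3` ∧ surj(3), UNIT rows: the rational odd-branch main conjecture at `3` is a
THEOREM** (tower from surj(3) by n1011-p14's `TypeG.towerSurj_three_of_surj`).
[cite: Kato2004Asterisque, Thm. 17.4 (3) (p. 273)] [cite: Wuthrich2014, Lemma 20 (p. 399)] -/
theorem ClassX4Gord.chiBranchRatCharEqOddAt_three_of_katoHalf_of_unitLValue_of_surj [Fact (Nat.Prime 3)]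
    (hKW : Wuthrich2014.kato_halfEigenCharIdeal_dvd_cyclotomicPrime_of_surjective)
    (hmod : hasEntireLFunction_rat) (hX : ClassX4Gord W 3) (hsurj : Surj W 3)
    {q : ℚ} (hq : W.entireLFunction 1 = (q : ℂ) * (W.realPeriodRat : ℂ)) (hq0 : q ≠ 0)
    (hv : padicValRat 3 q = 0) :
    ChiBranchRatCharEqOddAt W 3 :=
  chiBranchRatCharEqOddAt_of_katoHalf_of_unitLValue hKW hmod (padicValRat_j_nonneg_of_typeGOrd W 3 hX.typeGOrd)
    (TypeG.towerSurj_three_of_surj hX.typeGOrd.typeG hX.addv.2 hsurj) hX.addv.2 hq hq0 hv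

end GordOdd

/-! ### §2 (M) odd branch: the node and the rational MC on the unit rows -/

section MultOdd

variable {W : WeierstrassCurve ℚ} [W.IsElliptic] [W.IsGloballyMinimal] {p : ℕ} [hp : Fact p.Prime]

/-- **UNIT rows, (M) odd branch: Kato's half ALONE gives the one-sided node
`ChiBranchRatLowerDvdMultOddAt W p`.** For `W` globally minimal, potentially multiplicative at
`p ≡ 3 (mod 4)`, `ρ̄_{W,p^n}` onto for all `n`, `L(E,1) = q·Ω_E` with `q ≠ 0`, `ord_p q = 0`: Kato's
`g₁` with `ι g₁ = u·ϖ·L_p⁻(f♭, a_p, ω^{(p−1)/2}, T)` has unit constant term —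
`(ϖ L_p⁻)(0) = ϖ·a_p⁻¹·∑(a/p)[a/p]⁻_f` (`constantCoeff_padicLFunctionMinusBranchMult_half`, `a_p = ±1`)
and `L(E,1) = ε·ϖ·∑(…)·Ω_E/(|u(C)|·c_∞)` (`entireLFunction_one_eq_of_twist_neg`) with `ε`, `|u(C)|`
(`padicValRat_u_eq_zero_of_twist_pm_p`), `c_∞` all `p`-units — so `(u⁻¹ g₁) = Λ`.
[cite: Kato2004Asterisque, Thm. 17.4 (3) (p. 273)] [cite: MazurTateTeitelbaum1986Invent, §I.10, §I.13–I.14]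
[cite: Pal2012, Thm. 3.2] -/
theorem chiBranchRatLowerDvdMultOddAt_of_katoHalf_of_unitLValue
    (hKato : Wuthrich2014.kato_halfEigenCharIdeal_dvd_cyclotomicPrime_of_surjective)
    (hmod : hasEntireLFunction_rat) (hpm : AdditivePotMult.PotMult W p)
    (htower : ∀ n : ℕ, W.HasSurjectiveModNGaloisRep (p ^ n : ℕ))
    {q : ℚ} (hq : W.entireLFunction 1 = (q : ℂ) * (W.realPeriodRat : ℂ)) (hq0 : q ≠ 0)
    (hv : padicValRat p q = 0) :
    ChiBranchRatLowerDvdMultOddAt W p := by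
  intro V _ _ κ γ N _ f hp3 hCW hV hκ hγ hcv hf ap hap D ϖ hϖ g _hg
  have hp2 : p ≠ 2 := by omega
  have hpne : (-(p : ℚ)) ≠ 0 := neg_ne_zero.mpr (Nat.cast_ne_zero.mpr hp.out.ne_zero)
  have hsurjV : ∀ n : ℕ, V.HasSurjectiveModNGaloisRep (p ^ n : ℕ) := fun n ↦
    (GaloisImage.hasSurjectiveModNGaloisRep_pow_iff_of_model_twist V p hpne hCW n).mp (htower n)
  -- Kato's element
  obtain ⟨-, g₁, -, u, hιg₁⟩ :=
    exists_mem_charIdeal_map_eq_unit_mul_minusBranchMult_of_katoHalf W p hKato hpm V hp3 hCW hsurjV hκ hγ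
      hcv hf hap D ϖ hϖ
  have hCu : iwasawaToPowerSeries p (PowerSeries.C ((u⁻¹ : ℤ_[p]ˣ) : ℤ_[p])) =
      PowerSeries.C ((((u⁻¹ : ℤ_[p]ˣ) : ℤ_[p]) : ℚ_[p])) := by
    rw [PowerSeries.map_C, PadicInt.algebraMap_apply]
  have hu0 : (((u : ℤ_[p]) : ℚ_[p])) ≠ 0 := by
    intro h0
    have h1 : (((u⁻¹ : ℤ_[p]ˣ) : ℤ_[p]) : ℚ_[p]) * (((u : ℤ_[p]) : ℚ_[p])) = 1 := by
      rw [← PadicInt.coe_mul, Units.inv_mul, PadicInt.coe_one]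
    rw [h0, mul_zero] at h1
    exact zero_ne_one h1
  have hιG : iwasawaToPowerSeries p (PowerSeries.C ((u⁻¹ : ℤ_[p]ˣ) : ℤ_[p]) * g₁) =
      PowerSeries.C (ϖ : ℚ_[p]) * padicLFunctionMinusBranchMult f (ap : ℚ_[p]) (p / 2) := by
    rw [map_mul, hιg₁, hCu, ← mul_assoc, ← map_mul, coe_units_inv_eq_inv, ← mul_assoc,
      inv_mul_cancel₀ hu0, one_mul]
  -- `a_p = ±1`, `p ∣ N`
  obtain ⟨C, hC⟩ := hCW
  have hap1 : (ap = 1 ∨ ap = -1) ∧ p ∣ N := by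
    by_cases hs : V.HasSplitMultiplicativeReductionAtPrime p
    · obtain ⟨h1, -⟩ := hf.cuspCoeff_eq_one_and_sq_of_split hs
      exact ⟨Or.inl (by exact_mod_cast (hap.symm.trans h1 : ((ap : ℤ) : ℂ) = 1)),
        hf.dvd_level_of_split hs⟩
    · obtain ⟨h1, hpN⟩ := hf.cuspCoeff_eq_neg_one_and_dvd_of_nonsplit hV hs
      exact ⟨Or.inr (by exact_mod_cast (hap.symm.trans h1 : ((ap : ℤ) : ℂ) = -1)), hpN⟩
  obtain ⟨hap1, hpN⟩ := hap1
  have hap0 : (ap : ℚ_[p]) ≠ 0 := by rcases hap1 with rfl | rfl <;> norm_num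
  have hapn : ‖(ap : ℚ_[p])⁻¹‖ = 1 := by rcases hap1 with rfl | rfl <;> norm_num
  -- `L(E,1) = ε ϖ S Ω/(|u(C)| c_∞)` and the unit row ⟹ `ord_p (ϖ S) = 0`
  obtain ⟨ε, hε, hL⟩ := entireLFunction_one_eq_of_twist_neg p hmod hp3 V W C hC hpm.1 hf ϖ hϖ
  set S : ℚ := legendreMinusSymbolSum f p with hS
  set cinf : ℕ := (W.baseChange ℝ).numRealComponents with hcinf
  have hε0 : ε ≠ 0 := by rcases hε with rfl | rfl <;> norm_num
  have hεv : padicValRat p ε = 0 := by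
    rcases hε with rfl | rfl
    · exact padicValRat.one
    · rw [padicValRat.neg]; exact padicValRat.one
  have hua0 : |(C.u : ℚ)| ≠ 0 := abs_ne_zero.mpr C.u.ne_zero
  have hcinf0 : (cinf : ℚ) ≠ 0 := by
    rw [hcinf, numRealComponents]
    split_ifs <;> norm_num
  have hC'' : C • V.quadraticTwist (((-(p : ℤ)) : ℤ) : ℚ) = W := by push_cast; exact hC
  have huv : padicValRat p (C.u : ℚ) = 0 :=
    padicValRat_u_eq_zero_of_twist_pm_p p hp2 V W (Or.inr hV) (Or.inr rfl) C hC''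
  have hvua : padicValRat p |(C.u : ℚ)| = 0 := by
    rcases abs_choice (C.u : ℚ) with h | h
    · rw [h]; exact huv
    · rw [h, padicValRat.neg]; exact huv
  have hΩ : (W.realPeriodRat : ℂ) ≠ 0 := by exact_mod_cast W.realPeriodRat_pos_holds.ne'
  have hd0 : |(C.u : ℚ)| * (cinf : ℚ) ≠ 0 := mul_ne_zero hua0 hcinf0
  -- `ε ϖ S / (|u| c_∞) = q`, so `ϖ S = q |u| c_∞ / ε`
  have hqS : ε * (ϖ * S) / (|(C.u : ℚ)| * (cinf : ℚ)) = q := by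
    have h : ((ε * (ϖ * S) / (|(C.u : ℚ)| * (cinf : ℚ)) : ℚ) : ℂ) = (q : ℂ) :=
      mul_right_cancel₀ hΩ (hL.symm.trans hq)
    exact_mod_cast h
  have hϖS0 : ϖ * S ≠ 0 := by
    intro h0
    rw [h0, mul_zero, zero_div] at hqS
    exact hq0 hqS.symm
  have hϖSv : padicValRat p (ϖ * S) = 0 := by
    have h := congrArg (padicValRat p) hqS
    rw [padicValRat.div (mul_ne_zero hε0 hϖS0) hd0, padicValRat.mul hε0 hϖS0,
      padicValRat.mul hua0 hcinf0, hεv, hvua, hcinf, padicValRat_numRealComponents_eq_zero W p hp2,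
      hv] at h
    simpa using h
  have h1 : ‖PowerSeries.constantCoeff
      (PowerSeries.C (ϖ : ℚ_[p]) * padicLFunctionMinusBranchMult f (ap : ℚ_[p]) (p / 2))‖ = 1 := by
    rw [map_mul, PowerSeries.constantCoeff_C,
      constantCoeff_padicLFunctionMinusBranchMult_half p hp2 hf.1 hf.coeffField_eq_bot hpN hap hap0,
      ← mul_assoc, mul_comm (ϖ : ℚ_[p]), mul_assoc, norm_mul, hapn, one_mul, ← Rat.cast_mul]
    exact norm_ratCast_padic_eq_one_of_padicValRat_eq_zero p hϖS0 hϖSv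
  refine ⟨PowerSeries.C ((u⁻¹ : ℤ_[p]ˣ) : ℤ_[p]) * g₁, 0, 0, ?_, ?_⟩
  · rw [span_singleton_eq_top_of_map_eq_of_norm_constantCoeff_eq_one p hιG h1]
    exact Submodule.mem_top
  · rw [pow_zero, map_one, one_mul, hιG]

/-- **UNIT rows, (M) odd branch: the rational `ω^{(p−1)/2}`-branch main conjecture of the
multiplicative twist `ChiBranchRatCharEqMultOddAt W p` is a THEOREM from Kato's half** (node + split
`chiBranchRatCharEqMultOddAt_of_katoHalf_of_ratLowerDvd`). [cite: Kato2004Asterisque, Thm. 17.4 (3) (p. 273)]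
[cite: SkinnerUrban2014, Thm. 3.6.4, proof (p. 43)] -/
theorem chiBranchRatCharEqMultOddAt_of_katoHalf_of_unitLValue
    (hKato : Wuthrich2014.kato_halfEigenCharIdeal_dvd_cyclotomicPrime_of_surjective)
    (hmod : hasEntireLFunction_rat) (hpm : AdditivePotMult.PotMult W p)
    (htower : ∀ n : ℕ, W.HasSurjectiveModNGaloisRep (p ^ n : ℕ))
    {q : ℚ} (hq : W.entireLFunction 1 = (q : ℂ) * (W.realPeriodRat : ℂ)) (hq0 : q ≠ 0)
    (hv : padicValRat p q = 0) :
    ChiBranchRatCharEqMultOddAt W p :=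
  chiBranchRatCharEqMultOddAt_of_katoHalf_of_ratLowerDvd hKato hpm htower
    (chiBranchRatLowerDvdMultOddAt_of_katoHalf_of_unitLValue hKato hmod hpm htower hq hq0 hv)

/-- **X4(M) ∧ surj(p), UNIT rows, `p ≡ 3 (mod 4)` (`p = 3` included): the rational odd-branch main
conjecture of the multiplicative twist is a THEOREM** (tower from surj(p) by n1011-p14's
`ClassX4M.towerSurj_of_surj`, no certificate). [cite: Kato2004Asterisque, Thm. 17.4 (3) (p. 273)]
[cite: Wuthrich2014, Lemma 20 (p. 399)] -/
theorem _root_.Summit.BirchSwinnertonDyer.Rank1Residual.AdditivePotMult.ClassX4M.chiBranchRatCharEqMultOddAt_of_unitLValue_of_surj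
    (hKato : Wuthrich2014.kato_halfEigenCharIdeal_dvd_cyclotomicPrime_of_surjective)
    (hmod : hasEntireLFunction_rat) (hX : AdditivePotMult.ClassX4M W p) (hsurj : Surj W p)
    {q : ℚ} (hq : W.entireLFunction 1 = (q : ℂ) * (W.realPeriodRat : ℂ)) (hq0 : q ≠ 0)
    (hv : padicValRat p q = 0) :
    ChiBranchRatCharEqMultOddAt W p :=
  chiBranchRatCharEqMultOddAt_of_katoHalf_of_unitLValue hKato hmod hX.potMult (hX.towerSurj_of_surj hsurj)
    hq hq0 hv

end MultOdd

end Summit.BirchSwinnertonDyer.Rank1Residual.Additive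

end
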